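import Literature.Geometry.Lorentzian.EventHorizonGenerators
import Summits.FinalStateConjecture.FinalStateConjecture.Theorems.SoloInformedOutcomeThreshold

/-!
# SoloInformed — the `N = 0` branch of a typed final-state decomposition, and the domain of outer
communications inside the typed exterior

Soloist `solo-FinalStateConjecture-informed` (session 9, 2026-08-19). Kernel facts about the typed
SETTLING clauses of the summit `FinalStateConjecture` (`HasExhaustiveCharts`, `RaysStayInClosure`,
`exteriorOf`), companion to `SoloInformedOutcomeThreshold.lean` (`holeCountClass X 0`, the dispersion
class). Only set algebra and the elementary causality lemmas of `Literature` are used.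

1. **`N = 0` collapse.** With no black hole (`d.N = 0`) the certified late region / certified slab of
   `HasExhaustiveCharts` are the flat chart's images `flatLate d τ₁ = Ψ₀({x⁰ > τ₁} ∩ U₀)` and
   `flatLeaf d τ₁ = Ψ₀({x⁰ = τ₁} ∩ U₀)` (`certifiedLate_of_N_eq_zero`, `certifiedSlab_of_N_eq_zero`), and
   exhaustiveness is EXACTLY: for every chart time `τ₁ > τ₀`, `O ∖ flatLate d τ₁ ⊆ J⁻(flatLeaf d τ₁)`
   (`hasExhaustiveCharts_iff_of_N_eq_zero`). Hence every subset `W ⊆ O` disjoint from the late flat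
   region after `τ⋆` lies below EVERY later flat leaf, `W ⊆ ⋂_{τ₁ ≥ τ⋆} J⁻(flatLeaf d τ₁)`
   (`subset_iInter_causalPast_flatLeaf`), and ONE point of `O` outside `flatLate d τ₁ ∪ J⁻(flatLeaf d τ₁)`
   forces `d.N ≠ 0` (`N_ne_zero_of_witness`: the **hole-count witness**).
2. **The domain of outer communications lies in the typed exterior.** `RaysStayInClosure 𝒟 O` is the
   inclusion `completeNullRayRegion ⊆ closure O` (`raysStayInClosure_iff`); since `I⁻(closure A) ⊆ I⁻(A)`
   on a manifold without boundary, it gives `visibleRegion = I⁻(completeNullRayRegion) ⊆ I⁻(O)`, and for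
   `O = exteriorOf 𝒟 U = J⁺(ι X) ∩ I⁻(U)` the intrinsic future domain of outer communications
   `outerRegion = J⁺(ι X) ∩ I⁻(𝓘⁺)` is contained in `O` (`outerRegion_subset_exteriorOf`). This is the
   kernel form of the audit's intent for the clause (an intrinsic LOWER bound on the settled region).
3. Combining: for a typed `N = 0` decomposition the whole domain of outer communications lies, for every
   `τ₁ > τ₀`, in `flatLate d τ₁ ∪ J⁻(flatLeaf d τ₁)` (`outerRegion_subset_of_N_eq_zero`), a hole-count
   witness may be taken in the domain of outer communications (`N_ne_zero_of_outer_witness`), and the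
   dispersion class `holeCountClass X 0` of `SoloInformedOutcomeThreshold.lean` is contained in the class
   of data with an MGHD whose domain of outer communications is swept this way
   (`holeCountClass_zero_subset`).

Why this is recorded (paper/SHARPEST.md §(G7)). The typed number of holes `d.N` is tied to the geometry
of the development ONLY through these clauses. Item 1 isolates what "`N = 0`" asserts about a region
`W` that never enters the flat chart (a strong-field tube near a black hole): `W` lies in the causal
past of every late flat leaf. Whether that is contradictory is a statement about the GLOBAL position of
the flat leaves `Ψ₀({x⁰ = τ})` — complete spacelike `ℝ³`'s whose slab-local `C²` deviation from `δ`
tends to `0` — which the slab-local deviation functional does not control (accumulated tilt); see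
SHARPEST.md (G7-A)–(G7-C) for the covering-space argument that no late flat leaf fits inside a
uniformly timelike-Killing shell exterior, the conditional hole-count rigidity, and the tilt-drift
loophole at the `σ^{-1/2}` settling-rate threshold.

References: Hawking–Ellis 1973, §6.2, §9.2 (p. 312: `J⁻(𝓘⁺)`, the domain of outer communications);
Wald 1984, §12.1; O'Neill 1983, Ch. 14, pp. 402–404 (Lemma 14.6); [DafermosLuk2017] Conjecture 1;
Dafermos–Rodnianski arXiv:0811.0354, §2.5.4; Gannon, J. Math. Phys. 16 (1975) 2364.
-/

open Literature.Geometry.Lorentzian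
open scoped Manifold ContDiff Topology
open Filter Set

set_option linter.dupNamespace false

namespace Summit.FinalStateConjecture.FinalStateConjecture.Theorems

/-! ### 1. The `N = 0` collapse of the certified sets -/

section Decomposition

variable {𝓢 : Spacetime.{0} 4} {O : Set 𝓢.carrier} {k : ℕ}

/-- The **late flat region after chart time `τ`**: the flat chart's image of `{x⁰ > τ} ∩ U₀`
(for `τ = τ₀` this is `d.radiationZone`). [cite: DafermosLuk2017, Conjecture 1 (b)] -/
def flatLate (d : FinalStateDecomposition 𝓢 O k) (τ : ℝ) : Set 𝓢.carrier :=
  d.flatChart '' (Minkowski.backgroundOn d.flatDomain).lateRegion τ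

/-- The **flat leaf at chart time `τ`**: the flat chart's image of the slab `{x⁰ = τ} ∩ U₀`.
[cite: DafermosLuk2017, Conjecture 1 (b)] -/
def flatLeaf (d : FinalStateDecomposition 𝓢 O k) (τ : ℝ) : Set 𝓢.carrier :=
  d.flatChart '' (Minkowski.backgroundOn d.flatDomain).timeSlab τ

/-- The late flat region after `τ₀` is the radiation zone. [folklore] -/
theorem flatLate_τ₀ (d : FinalStateDecomposition 𝓢 O k) : flatLate d d.τ₀ = d.radiationZone := rfl

/-- Late flat regions shrink with chart time. [folklore] -/
theorem flatLate_mono (d : FinalStateDecomposition 𝓢 O k) {τ τ' : ℝ} (h : τ ≤ τ') :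
    flatLate d τ' ⊆ flatLate d τ :=
  image_mono ((Minkowski.backgroundOn d.flatDomain).lateRegion_mono h)

/-- A later flat leaf lies in an earlier late flat region. [folklore] -/
theorem flatLeaf_subset_flatLate (d : FinalStateDecomposition 𝓢 O k) {τ τ' : ℝ} (h : τ < τ') :
    flatLeaf d τ' ⊆ flatLate d τ :=
  image_mono ((Minkowski.backgroundOn d.flatDomain).timeSlab_subset_lateRegion h)

/-- Late flat regions after `τ ≥ τ₀` lie in the decomposed region `O`. [folklore] -/
theorem flatLate_subset (d : FinalStateDecomposition 𝓢 O k) {τ : ℝ} (h : d.τ₀ ≤ τ) :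
    flatLate d τ ⊆ O :=
  (flatLate_mono d h).trans d.radiationZone_subset

/-- Flat leaves at `τ > τ₀` lie in `O`. [folklore] -/
theorem flatLeaf_subset (d : FinalStateDecomposition 𝓢 O k) {τ : ℝ} (h : d.τ₀ < τ) :
    flatLeaf d τ ⊆ O :=
  (flatLeaf_subset_flatLate d h).trans d.radiationZone_subset

/-- The flat leaf as the set of chart points over `{x⁰ = τ} ∩ U₀` (for `N = 0` and `τ > τ₀` every
point of the plane qualifies, `mem_flatDomain_of_N_eq_zero`). [folklore] -/
theorem flatLeaf_eq (d : FinalStateDecomposition 𝓢 O k) (τ : ℝ) :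
    flatLeaf d τ = {p | ∃ (x : E4) (hx : x ∈ (d.flatDomain : Set E4)), x 0 = τ ∧
      d.flatChart ⟨x, hx⟩ = p} := by
  ext p
  simp only [flatLeaf, mem_image, mem_setOf_eq]
  constructor
  · rintro ⟨y, hy, rfl⟩
    exact ⟨y.1, y.2, hy, rfl⟩
  · rintro ⟨x, hx, hx0, rfl⟩
    exact ⟨⟨x, hx⟩, hx0, rfl⟩

/-- **With no black hole every point of the plane `{x⁰ = τ}`, `τ > τ₀`, is a chart point**: the
leaves of a typed `N = 0` decomposition are images of ALL of `{x⁰ = τ} ≅ ℝ³` — the topological input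
of the covering argument of SHARPEST.md (G7-A). (Pointwise form; the set form
`Subtype.val '' timeSlab τ = Minkowski.timeSlab τ` is already a tree lemma,
`DarkFuture.image_timeSlab_eq_of_N_eq_zero`, and is not restated here.)
[cite: ChristodoulouKlainerman1993, Thm. 1.0.2] -/
theorem mem_flatDomain_of_N_eq_zero (d : FinalStateDecomposition 𝓢 O k) (hN : d.N = 0) {x : E4}
    (hx : d.τ₀ < x 0) : x ∈ (d.flatDomain : Set E4) :=
  d.lateRegion_subset_flatDomain_of_N_eq_zero hN hx

/-- With no black hole the charted late region is the radiation zone. [folklore] -/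
theorem charted_of_N_eq_zero (d : FinalStateDecomposition 𝓢 O k) (hN : d.N = 0) :
    d.charted = flatLate d d.τ₀ := by
  haveI : IsEmpty (Fin d.N) := hN ▸ Fin.isEmpty'
  rw [FinalStateDecomposition.charted, iUnion_of_empty, union_empty, flatLate_τ₀]

/-- **`N = 0` collapse of the certified late region**: it is the late flat region.
[cite: DafermosLuk2017, Conjecture 1 (b)] -/
theorem certifiedLate_of_N_eq_zero (d : FinalStateDecomposition 𝓢 O k) (hN : d.N = 0)
    (R : Fin d.N → ℝ → ℝ) (τ₁ : ℝ) :
    Summit.FinalStateConjecture.certifiedLate d R τ₁ = flatLate d τ₁ := by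
  haveI : IsEmpty (Fin d.N) := hN ▸ Fin.isEmpty'
  rw [Summit.FinalStateConjecture.certifiedLate, iUnion_of_empty, union_empty, flatLate]

/-- **`N = 0` collapse of the certified slab**: it is the flat leaf.
[cite: DafermosLuk2017, Conjecture 1 (b)] -/
theorem certifiedSlab_of_N_eq_zero (d : FinalStateDecomposition 𝓢 O k) (hN : d.N = 0)
    (R : Fin d.N → ℝ → ℝ) (τ₁ : ℝ) :
    Summit.FinalStateConjecture.certifiedSlab d R τ₁ = flatLeaf d τ₁ := by
  haveI : IsEmpty (Fin d.N) := hN ▸ Fin.isEmpty'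
  rw [Summit.FinalStateConjecture.certifiedSlab, iUnion_of_empty, union_empty, flatLeaf]

/-- **Exhaustiveness for `N = 0`, exactly**: the near-zone clauses are vacuous and the covering clause
reads `O ∖ flatLate d τ₁ ⊆ J⁻(flatLeaf d τ₁)` for every chart time `τ₁ > τ₀`.
[cite: DafermosLuk2017, Conjecture 1 (b)–(c)] -/
theorem hasExhaustiveCharts_iff_of_N_eq_zero (d : FinalStateDecomposition 𝓢 O k) (hN : d.N = 0) :
    Summit.FinalStateConjecture.HasExhaustiveCharts d ↔
      ∀ τ₁ : ℝ, d.τ₀ < τ₁ →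
        O \ flatLate d τ₁ ⊆ 𝓢.metric.causalPast 𝓢.timeOrientation (flatLeaf d τ₁) := by
  haveI : IsEmpty (Fin d.N) := hN ▸ Fin.isEmpty'
  constructor
  · rintro ⟨R, -, -, h⟩ τ₁ hτ
    have h' := h τ₁ hτ
    rwa [certifiedLate_of_N_eq_zero d hN, certifiedSlab_of_N_eq_zero d hN] at h'
  · intro h
    refine ⟨fun i ↦ isEmptyElim i, fun i ↦ isEmptyElim i, fun i ↦ isEmptyElim i,
      fun τ₁ hτ ↦ ?_⟩
    rw [certifiedLate_of_N_eq_zero d hN, certifiedSlab_of_N_eq_zero d hN]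
    exact h τ₁ hτ

/-- For a typed `N = 0` decomposition with exhaustive charts, `O` is swept, at every chart time
`τ₁ > τ₀`, by the late flat region and the causal past of the flat leaf. [folklore] -/
theorem subset_flatLate_union_causalPast (d : FinalStateDecomposition 𝓢 O k) (hN : d.N = 0)
    (hex : Summit.FinalStateConjecture.HasExhaustiveCharts d) {τ₁ : ℝ} (hτ : d.τ₀ < τ₁) :
    O ⊆ flatLate d τ₁ ∪ 𝓢.metric.causalPast 𝓢.timeOrientation (flatLeaf d τ₁) := by
  intro p hp
  by_cases hl : p ∈ flatLate d τ₁
  · exact Or.inl hl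
  · exact Or.inr ((hasExhaustiveCharts_iff_of_N_eq_zero d hN).1 hex τ₁ hτ ⟨hp, hl⟩)

/-- **A region that never enters the flat chart lies below the flat leaf**: if `W ⊆ O` is disjoint
from the late flat region after `τ₁ > τ₀`, then `W ⊆ J⁻(flatLeaf d τ₁)`. [folklore] -/
theorem subset_causalPast_flatLeaf_of_disjoint (d : FinalStateDecomposition 𝓢 O k) (hN : d.N = 0)
    (hex : Summit.FinalStateConjecture.HasExhaustiveCharts d) {W : Set 𝓢.carrier} (hW : W ⊆ O)
    {τ₁ : ℝ} (hτ : d.τ₀ < τ₁) (hdisj : Disjoint W (flatLate d τ₁)) :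
    W ⊆ 𝓢.metric.causalPast 𝓢.timeOrientation (flatLeaf d τ₁) := fun _ hp ↦
  (hasExhaustiveCharts_iff_of_N_eq_zero d hN).1 hex τ₁ hτ ⟨hW hp, disjoint_left.1 hdisj hp⟩

/-- **… and below every later flat leaf**: `W ⊆ ⋂_{τ₁ ≥ τ⋆} J⁻(flatLeaf d τ₁)`. [folklore] -/
theorem subset_iInter_causalPast_flatLeaf (d : FinalStateDecomposition 𝓢 O k) (hN : d.N = 0)
    (hex : Summit.FinalStateConjecture.HasExhaustiveCharts d) {W : Set 𝓢.carrier} (hW : W ⊆ O)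
    {τs : ℝ} (hτ : d.τ₀ < τs) (hdisj : Disjoint W (flatLate d τs)) :
    W ⊆ ⋂ τ₁ ∈ Ici τs, 𝓢.metric.causalPast 𝓢.timeOrientation (flatLeaf d τ₁) :=
  subset_iInter₂ fun _ hτ₁ ↦ subset_causalPast_flatLeaf_of_disjoint d hN hex hW
    (hτ.trans_le hτ₁) (hdisj.mono_right (flatLate_mono d hτ₁))

/-- **Hole-count witness.** One point of `O` which, for some chart time `τ₁ > τ₀`, is neither in the
late flat region after `τ₁` nor in the causal past of the flat leaf at `τ₁` forces at least one black
hole in any typed decomposition with exhaustive charts. [folklore] -/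
theorem N_ne_zero_of_witness (d : FinalStateDecomposition 𝓢 O k)
    (hex : Summit.FinalStateConjecture.HasExhaustiveCharts d) {p : 𝓢.carrier} (hp : p ∈ O) {τ₁ : ℝ}
    (hτ : d.τ₀ < τ₁) (h₁ : p ∉ flatLate d τ₁)
    (h₂ : p ∉ 𝓢.metric.causalPast 𝓢.timeOrientation (flatLeaf d τ₁)) : d.N ≠ 0 := fun hN ↦
  h₂ ((hasExhaustiveCharts_iff_of_N_eq_zero d hN).1 hex τ₁ hτ ⟨hp, h₁⟩)

/-- Hole-count witness, `1 ≤ N` form. [folklore] -/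
theorem one_le_N_of_witness (d : FinalStateDecomposition 𝓢 O k)
    (hex : Summit.FinalStateConjecture.HasExhaustiveCharts d) {p : 𝓢.carrier} (hp : p ∈ O) {τ₁ : ℝ}
    (hτ : d.τ₀ < τ₁) (h₁ : p ∉ flatLate d τ₁)
    (h₂ : p ∉ 𝓢.metric.causalPast 𝓢.timeOrientation (flatLeaf d τ₁)) : 1 ≤ d.N :=
  Nat.one_le_iff_ne_zero.2 (N_ne_zero_of_witness d hex hp hτ h₁ h₂)

/-- Set form of the witness: a subset `W ⊆ O` disjoint from the late flat region after `τ₁ > τ₀`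
and NOT contained in `J⁻(flatLeaf d τ₁)` forces `d.N ≠ 0`. [folklore] -/
theorem N_ne_zero_of_not_subset_causalPast (d : FinalStateDecomposition 𝓢 O k)
    (hex : Summit.FinalStateConjecture.HasExhaustiveCharts d) {W : Set 𝓢.carrier} (hW : W ⊆ O)
    {τ₁ : ℝ} (hτ : d.τ₀ < τ₁) (hdisj : Disjoint W (flatLate d τ₁))
    (hnot : ¬ W ⊆ 𝓢.metric.causalPast 𝓢.timeOrientation (flatLeaf d τ₁)) : d.N ≠ 0 := fun hN ↦
  hnot (subset_causalPast_flatLeaf_of_disjoint d hN hex hW hτ hdisj)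

end Decomposition

/-! ### 2. The domain of outer communications lies in the typed exterior -/

section Development

variable {X : Type} [TopologicalSpace X] [ChartedSpace E3 X] [IsManifold (𝓡 3) ∞ X]
  [ConnectedSpace X] {D : InitialDataSet (𝓡 3) X} {k : ℕ}

/-- **`RaysStayInClosure` is an inclusion of regions**: the nonnegative halves of all future-complete
normalised null rays from the data (`completeNullRayRegion`, the intrinsic stand-in for a
neighbourhood of `𝓘⁺`) lie in `closure O`. [cite: arXiv08110354, §2.5.4] -/
theorem raysStayInClosure_iff (𝒟 : CauchyDevelopment D) (O : Set 𝒟.carrier) :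
    Summit.FinalStateConjecture.RaysStayInClosure 𝒟 O ↔
      ∀ [𝒟.metric.HasLeviCivita], 𝒟.completeNullRayRegion ⊆ closure O := by
  constructor
  · intro h _ q hq
    obtain ⟨p, δ, s, t, hδ, hs, ht, h0, rfl⟩ :=
      LorentzianMetric.mem_completeNullRayRegion_iff.1 hq
    exact h p δ s hδ hs t ht h0
  · intro h _ p γ dom hγ hdom t ht h0
    exact h (LorentzianMetric.image_subset_completeNullRayRegion hγ hdom ⟨t, ⟨ht, h0⟩, rfl⟩)

/-- **`I⁻(closure A) = I⁻(A)`** (`I⁺(x)` is open on a manifold without boundary, O'Neill's Lemma 14.3,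
so it meets `A` as soon as it meets `closure A`). O'Neill 1983, Ch. 14, Lemma 14.3 (p. 403).
[cite: ONeill1983, Ch. 14  Lemma 14.3 (p. 403)] -/
theorem chronologicalPast_closure (𝒟 : CauchyDevelopment D) (A : Set 𝒟.carrier) :
    𝒟.metric.chronologicalPast 𝒟.timeOrientation (closure A) =
      𝒟.metric.chronologicalPast 𝒟.timeOrientation A := by
  refine Subset.antisymm ?_ (LorentzianMetric.chronologicalPast_mono subset_closure)
  rintro x ⟨r, hrA, γ, a, b, hab, hγ, hγa, hγb⟩
  have hxr : x ∈ 𝒟.metric.chronologicalPast 𝒟.timeOrientation {r} :=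
    ⟨r, rfl, γ, a, b, hab, hγ, hγa, hγb⟩
  have hrx : r ∈ 𝒟.metric.chronologicalFuture 𝒟.timeOrientation {x} :=
    LorentzianMetric.mem_chronologicalFuture_of_mem_chronologicalPast hxr
  obtain ⟨o, hox, hoA⟩ := mem_closure_iff.1 hrA _
    (LorentzianMetric.isOpen_chronologicalFuture_of_boundaryless _ _ {x}) hrx
  exact LorentzianMetric.chronologicalPast_mono (singleton_subset_iff.2 hoA)
    (LorentzianMetric.mem_chronologicalPast_of_mem_chronologicalFuture hox)

/-- **Rays in the closure put the visible region below `O`**: `visibleRegion = I⁻(𝓘⁺) ⊆ I⁻(O)`.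
Hawking–Ellis 1973, §9.2, p. 312. [cite: HawkingEllis1973, §9.2] -/
theorem visibleRegion_subset_chronologicalPast (𝒟 : CauchyDevelopment D) [𝒟.metric.HasLeviCivita]
    {O : Set 𝒟.carrier} (h : Summit.FinalStateConjecture.RaysStayInClosure 𝒟 O) :
    𝒟.visibleRegion ⊆ 𝒟.metric.chronologicalPast 𝒟.timeOrientation O := by
  rw [← DataEmbedding.chronologicalPast_completeNullRayRegion, ← chronologicalPast_closure 𝒟 O]
  exact LorentzianMetric.chronologicalPast_mono ((raysStayInClosure_iff 𝒟 O).1 h)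

/-- **The domain of outer communications lies in the typed exterior.** If the future-complete rays
stay in the closure of `O = exteriorOf 𝒟 U = J⁺(ι X) ∩ I⁻(U)`, then the intrinsic future domain of
outer communications `outerRegion = J⁺(ι X) ∩ I⁻(𝓘⁺)` is contained in `O` (`I⁻ ∘ I⁻ = I⁻`). This is
the kernel content of the audit clause `RaysStayInClosure` (an intrinsic lower bound on the settled
region). Hawking–Ellis 1973, §9.2, p. 312; Wald 1984, §12.1. [cite: HawkingEllis1973, §9.2] -/
theorem outerRegion_subset_exteriorOf (𝒟 : CauchyDevelopment D) [𝒟.metric.HasLeviCivita]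
    {U : Set 𝒟.carrier}
    (h : Summit.FinalStateConjecture.RaysStayInClosure 𝒟
      (Summit.FinalStateConjecture.exteriorOf 𝒟 U)) :
    𝒟.outerRegion ⊆ Summit.FinalStateConjecture.exteriorOf 𝒟 U := by
  rintro x ⟨hxJ, hxvis⟩
  refine ⟨hxJ, ?_⟩
  have hx := visibleRegion_subset_chronologicalPast 𝒟 h hxvis
  -- `I⁻(J⁺(ι X) ∩ I⁻(U)) ⊆ I⁻(I⁻(U)) ⊆ I⁻(U)`
  obtain ⟨r, ⟨-, hrU⟩, γ, a, b, hab, hγ, hγa, hγb⟩ := hx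
  have hxr : x ∈ 𝒟.metric.chronologicalPast 𝒟.timeOrientation {r} :=
    ⟨r, rfl, γ, a, b, hab, hγ, hγa, hγb⟩
  exact LorentzianMetric.mem_chronologicalPast_trans hrU hxr

/-- Same, for the summit's shape `O = exteriorOf 𝒟 U` with `RaysStayInClosure 𝒟 O`. [folklore] -/
theorem outerRegion_subset_of_eq_exteriorOf (𝒟 : CauchyDevelopment D) [𝒟.metric.HasLeviCivita]
    {O U : Set 𝒟.carrier} (hO : O = Summit.FinalStateConjecture.exteriorOf 𝒟 U)
    (h : Summit.FinalStateConjecture.RaysStayInClosure 𝒟 O) : 𝒟.outerRegion ⊆ O := by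
  subst hO
  exact outerRegion_subset_exteriorOf 𝒟 h

/-! ### 3. `N = 0`: the domain of outer communications is swept by the flat leaves -/

/-- **For a typed `N = 0` decomposition the whole domain of outer communications lies, at every chart
time `τ₁ > τ₀`, in the late flat region after `τ₁` or in the causal past of the flat leaf at `τ₁`.**
[cite: DafermosLuk2017, Conjecture 1] -/
theorem outerRegion_subset_of_N_eq_zero (𝒟 : CauchyDevelopment D) [𝒟.metric.HasLeviCivita]
    {O : Set 𝒟.carrier} (d : FinalStateDecomposition 𝒟.toSpacetime O k) (hN : d.N = 0)
    (hO : O = Summit.FinalStateConjecture.exteriorOf 𝒟 d.charted)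
    (hrays : Summit.FinalStateConjecture.RaysStayInClosure 𝒟 O)
    (hex : Summit.FinalStateConjecture.HasExhaustiveCharts d) {τ₁ : ℝ} (hτ : d.τ₀ < τ₁) :
    𝒟.outerRegion ⊆ flatLate d τ₁ ∪ 𝒟.metric.causalPast 𝒟.timeOrientation (flatLeaf d τ₁) :=
  (outerRegion_subset_of_eq_exteriorOf 𝒟 hO hrays).trans
    (subset_flatLate_union_causalPast d hN hex hτ)

/-- **A strong-field region of the domain of outer communications lies below every late flat leaf**:
if `W ⊆ outerRegion` never meets the late flat region after `τ⋆ > τ₀` of a typed `N = 0`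
decomposition, then `W ⊆ J⁻(flatLeaf d τ₁)` for every `τ₁ ≥ τ⋆`. [folklore] -/
theorem subset_iInter_causalPast_flatLeaf_of_subset_outerRegion (𝒟 : CauchyDevelopment D)
    [𝒟.metric.HasLeviCivita] {O : Set 𝒟.carrier} (d : FinalStateDecomposition 𝒟.toSpacetime O k)
    (hN : d.N = 0) (hO : O = Summit.FinalStateConjecture.exteriorOf 𝒟 d.charted)
    (hrays : Summit.FinalStateConjecture.RaysStayInClosure 𝒟 O)
    (hex : Summit.FinalStateConjecture.HasExhaustiveCharts d) {W : Set 𝒟.carrier}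
    (hW : W ⊆ 𝒟.outerRegion) {τs : ℝ} (hτ : d.τ₀ < τs) (hdisj : Disjoint W (flatLate d τs)) :
    W ⊆ ⋂ τ₁ ∈ Ici τs, 𝒟.metric.causalPast 𝒟.timeOrientation (flatLeaf d τ₁) :=
  subset_iInter_causalPast_flatLeaf d hN hex
    (hW.trans (outerRegion_subset_of_eq_exteriorOf 𝒟 hO hrays)) hτ hdisj

/-- **Hole-count witness in the domain of outer communications.** A point of the intrinsic future
domain of outer communications which, at some chart time `τ₁ > τ₀`, is neither in the late flat region
nor in the causal past of the flat leaf forces `N ≠ 0` in every typed decomposition of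
`O = exteriorOf 𝒟 (charted region)` with rays in the closure and exhaustive charts. [folklore] -/
theorem N_ne_zero_of_outer_witness (𝒟 : CauchyDevelopment D) [𝒟.metric.HasLeviCivita]
    {O : Set 𝒟.carrier} (d : FinalStateDecomposition 𝒟.toSpacetime O k)
    (hO : O = Summit.FinalStateConjecture.exteriorOf 𝒟 d.charted)
    (hrays : Summit.FinalStateConjecture.RaysStayInClosure 𝒟 O)
    (hex : Summit.FinalStateConjecture.HasExhaustiveCharts d) {x : 𝒟.carrier}
    (hx : x ∈ 𝒟.outerRegion) {τ₁ : ℝ} (hτ : d.τ₀ < τ₁) (h₁ : x ∉ flatLate d τ₁)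
    (h₂ : x ∉ 𝒟.metric.causalPast 𝒟.timeOrientation (flatLeaf d τ₁)) : d.N ≠ 0 :=
  N_ne_zero_of_witness d hex (outerRegion_subset_of_eq_exteriorOf 𝒟 hO hrays hx) hτ h₁ h₂

end Development

/-! ### 4. The dispersion class -/

section Data

variable (X : Type) [TopologicalSpace X] [ChartedSpace E3 X] [IsManifold (𝓡 3) ∞ X] [T2Space X]
  [SecondCountableTopology X] [ConnectedSpace X]

omit [T2Space X] [SecondCountableTopology X] in
/-- **Dispersing data have an MGHD whose domain of outer communications is swept by flat leaves**:
for `D ∈ holeCountClass X 0` there is a maximal vacuum Cauchy development `𝒟` carrying a typed `C²`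
decomposition `d` with NO hole such that, granted the Levi-Civita connection, for every chart time
`τ₁ > τ₀` the domain of outer communications lies in `flatLate d τ₁ ∪ J⁻(flatLeaf d τ₁)`.
[cite: DafermosLuk2017, §1.2.1] -/
theorem holeCountClass_zero_subset :
    holeCountClass X 0 ⊆
      {D | ∃ 𝒟 : VacuumCauchyDevelopment D, 𝒟.IsMaximal ∧
        ∃ (O : Set 𝒟.carrier) (d : FinalStateDecomposition 𝒟.toSpacetime O 2), d.N = 0 ∧
          ∀ [𝒟.metric.HasLeviCivita], ∀ τ₁ : ℝ, d.τ₀ < τ₁ →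
            𝒟.outerRegion ⊆
              flatLate d τ₁ ∪ 𝒟.metric.causalPast 𝒟.timeOrientation (flatLeaf d τ₁)} := by
  rintro D ⟨-, 𝒟, h𝒟, O, d, hN, -, hO, hrays, hex, -⟩
  exact ⟨𝒟, h𝒟, O, d, hN, fun τ₁ hτ ↦
    outerRegion_subset_of_N_eq_zero 𝒟.toCauchyDevelopment d hN hO hrays hex hτ⟩

end Data

end Summit.FinalStateConjecture.FinalStateConjecture.Theorems
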